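import Summits.SmoothPoincare4.SmoothPoincare4.Theses.ConvexBisection
import Summits.SmoothPoincare4.SmoothPoincare4.Theorems.ConvexBisectionContractibleTwistedDoubleStandardBisectionOrientable
import Summits.SmoothPoincare4.SmoothPoincare4.Statement
import HarnessLib

/-!
# `ContractibleTwistedDoubleStandard` — the crux, its bet and its residual are sectors of SPC4

Crux stmt-SmoothPoincare4-3546 (`Summit.SmoothPoincare4.SmoothPoincare4.Theses.ConvexBisection.ContractibleTwistedDoubleStandard`,
route ConvexBisection): a closed smooth `4`-manifold which is a Stein bisection along a common contact
seam of two compact contractible Stein domains is `S⁴`.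

This negative-side file certifies, unconditionally in logic, that the crux and the two open stubs of the
line `property-r-mazur-halves` (skeleton m11, `Cruxes/ContractibleTwistedDoubleStandard/Lines/property_r_mazur_halves.lean`)
are IMPLIED BY the summit statement `SmoothPoincare4` — i.e. none of them overshoots SPC4, and each is
refutable only by an exotic `S⁴`:

* `oneOneTwoOneOne_of_spc4` — SPC4 ⇒ THE BET `stub_homotopySphereOneOneTwoOneOne` (a closed smooth
  `X ≃ₕ S⁴` with a `(1,1,2,1,1)` Morse function has a `(1,0,1,1,1)` one): under SPC4 `X ≅ S⁴`, and `S⁴`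
  carries a `(1,0,1,1,1)` function which pulls back (`oneZeroOneOneOne_of_nonempty_diffeomorph_sphere`,
  landed with p108569).  Together with the landed `stub_closedOneZeroOne` (p108247: `(1,0,1,1,1)` ⇒ `S⁴`
  modulo Laudenbach–Poénaru + Property R) this pins the bet as EXACTLY SPC4 for handle profile `(1,1,2,1,1)`.
* `nonSmallSector_of_crux` — crux ⇒ the residual stub `stub_nonSmallSector` (a weakening: the residual is
  the crux with two extra hypotheses).
* SPC4 ⇒ crux itself (`crux_of_spc4`, hence `not_spc4_of_not_crux` and SPC4 ⇒ residual) is the one-liner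
  `fun h X … hC => h X _ _ (stub_homotopySphere X … hC)` over the landed homotopy-sphere lemma
  `…Theorems.ContractibleTwistedDoubleStandard.PropertyRMazurHalves.stub_homotopySphere` (p112822, module
  `…ConvexBisectionContractibleTwistedDoubleStandardHomotopySphere`); it lands in the sibling file
  `Negative/Spc4ImpliesCrux.lean` as soon as that module is in the build snapshot.

No new mathematics: bookkeeping for the planners (promote-stub / conjecture-item decisions), in the
pattern of `Theorems/<Crux>/Negative/…` sector certificates (`crux_of_spc4`, `not_spc4_of_not_crux`).
-/

noncomputable section

set_option linter.dupNamespace false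

open scoped Manifold ContDiff Topology ContinuousMap
open Set Function Literature.Topology.FourManifolds Literature.Geometry.Symplectic

namespace Summit.SmoothPoincare4.SmoothPoincare4.Theorems.ContractibleTwistedDoubleStandard.Negative

open Summit.SmoothPoincare4.SmoothPoincare4.Theses.ConvexBisection

/-- **SPC4 ⇒ THE BET of line `property-r-mazur-halves`** (registered stub
`stub_homotopySphereOneOneTwoOneOne`, signature verbatim after the arrow): under `SmoothPoincare4` a
Hausdorff second-countable smooth `X ≃ₕ S⁴` is diffeomorphic to `S⁴`, and a manifold diffeomorphic to
`S⁴` carries a Morse function of profile `(1,0,1,1,1)` (`oneZeroOneOneOne_of_nonempty_diffeomorph_sphere`: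
the height function plus one `(2,3)` birth pair, pulled back).  The `(1,1,2,1,1)` function in the
hypothesis is not used. [folklore] -/
theorem oneOneTwoOneOne_of_spc4 :
    _root_.SmoothPoincare4 → ∀ (X : Type) [TopologicalSpace X] [T2Space X] [SecondCountableTopology X] [CompactSpace X]
      [ChartedSpace (EuclideanSpace ℝ (Fin 4)) X] [IsManifold (𝓡 4) ∞ X],
      X ≃ₕ Metric.sphere (0 : EuclideanSpace ℝ (Fin 5)) 1 →
      ∀ (F : X → ℝ), IsMorse (𝓡 4) F →
      (criticalSetOfIndex (𝓡 4) F 0).ncard = 1 → (criticalSetOfIndex (𝓡 4) F 1).ncard = 1 →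
      (criticalSetOfIndex (𝓡 4) F 2).ncard = 2 → (criticalSetOfIndex (𝓡 4) F 3).ncard = 1 →
      (criticalSetOfIndex (𝓡 4) F 4).ncard = 1 →
        ∃ F' : X → ℝ, IsMorse (𝓡 4) F' ∧
          (criticalSetOfIndex (𝓡 4) F' 0).ncard = 1 ∧ (criticalSetOfIndex (𝓡 4) F' 1).ncard = 0 ∧
          (criticalSetOfIndex (𝓡 4) F' 2).ncard = 1 ∧ (criticalSetOfIndex (𝓡 4) F' 3).ncard = 1 ∧
          (criticalSetOfIndex (𝓡 4) F' 4).ncard = 1 :=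
  fun h X _ _ _ _ _ _ hX _ _ _ _ _ _ _ =>
    PropertyRMazurHalves.oneZeroOneOneOne_of_nonempty_diffeomorph_sphere X
      (h X inferInstance inferInstance hX)

/-- **crux ⇒ the residual stub** `stub_nonSmallSector` of line `property-r-mazur-halves` (signature
verbatim after the arrow): the residual is the crux restricted to bisections with non-simply-connected
seam and not both halves smoothly Mazur, i.e. the crux with two more hypotheses, which are dropped.
With `crux_of_spc4` (sibling file) this makes the residual a sector of SPC4 as well. [folklore] -/
theorem nonSmallSector_of_crux :
    Summit.SmoothPoincare4.SmoothPoincare4.Theses.ConvexBisection.ContractibleTwistedDoubleStandard →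
    ∀ (X : Type) [TopologicalSpace X] [T2Space X] [SecondCountableTopology X] [CompactSpace X]
      [ChartedSpace (EuclideanSpace ℝ (Fin 4)) X] [IsManifold (𝓡 4) ∞ X]
      (W₁ : Type) [TopologicalSpace W₁] [ChartedSpace (EuclideanHalfSpace 4) W₁]
      [IsManifold (𝓡∂ 4) ∞ W₁] [CompactSpace W₁] [ContractibleSpace W₁]
      (W₂ : Type) [TopologicalSpace W₂] [ChartedSpace (EuclideanHalfSpace 4) W₂]
      [IsManifold (𝓡∂ 4) ∞ W₂] [CompactSpace W₂] [ContractibleSpace W₂]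
      (J₁ : SteinStructure W₁) (J₂ : SteinStructure W₂) (e₁ : W₁ → X) (e₂ : W₂ → X),
      Manifold.IsSmoothEmbedding (𝓡∂ 4) (𝓡 4) ∞ e₁ → Manifold.IsSmoothEmbedding (𝓡∂ 4) (𝓡 4) ∞ e₂ →
      Set.range e₁ ∪ Set.range e₂ = Set.univ →
      Set.range e₁ ∩ Set.range e₂ = e₁ '' (𝓡∂ 4).boundary W₁ →
      Set.range e₁ ∩ Set.range e₂ = e₂ '' (𝓡∂ 4).boundary W₂ →
      (∀ w₁ w₂, e₁ w₁ = e₂ w₂ →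
        Submodule.map (mfderiv (𝓡∂ 4) (𝓡 4) e₁ w₁).toLinearMap (contactPlane J₁.J w₁) =
          Submodule.map (mfderiv (𝓡∂ 4) (𝓡 4) e₂ w₂).toLinearMap (contactPlane J₂.J w₂)) →
      ¬ SimplyConnectedSpace ((𝓡∂ 4).boundary W₁) →
      ¬ ((∃ f : W₁ → ℝ, IsMorseAdapted (𝓡∂ 4) f ∧
            (∀ z, IsMCriticalPt (𝓡∂ 4) f z → morseIndex (𝓡∂ 4) f z ≤ 2) ∧
            (criticalSetOfIndex (𝓡∂ 4) f 0).ncard = 1 ∧ (criticalSetOfIndex (𝓡∂ 4) f 1).ncard = 1 ∧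
            (criticalSetOfIndex (𝓡∂ 4) f 2).ncard = 1) ∧
          (∃ f : W₂ → ℝ, IsMorseAdapted (𝓡∂ 4) f ∧
            (∀ z, IsMCriticalPt (𝓡∂ 4) f z → morseIndex (𝓡∂ 4) f z ≤ 2) ∧
            (criticalSetOfIndex (𝓡∂ 4) f 0).ncard = 1 ∧ (criticalSetOfIndex (𝓡∂ 4) f 1).ncard = 1 ∧
            (criticalSetOfIndex (𝓡∂ 4) f 2).ncard = 1)) →
      Nonempty (X ≃ₘ⟮𝓡 4, 𝓡 4⟯ Metric.sphere (0 : EuclideanSpace ℝ (Fin 5)) 1) :=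
  fun h X _ _ _ _ _ _ W₁ _ _ _ _ _ W₂ _ _ _ _ _ J₁ J₂ e₁ e₂ h1 h2 hcov hL hR hC _ _ =>
    h X W₁ W₂ J₁ J₂ e₁ e₂ h1 h2 hcov hL hR hC

end Summit.SmoothPoincare4.SmoothPoincare4.Theorems.ContractibleTwistedDoubleStandard.Negative

end
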